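import Mathlib
import HarnessLib
import Literature.Probability.Percolation.HexLatticeSegments
import Literature.Probability.Percolation.InterfaceLoopPolygon

/-!
# Interface traces miss the open Voronoi hexagons (line `Sketch`, stub `stub_cellBridge`, part 2)

Crux `Summit.CriticalPhenomena.CardyFormulaZ2.Theses.CardyMagicRigidity.MagicFormulaT`
(stmt-CriticalPhenomena-4836), line `Sketch`, stub `stub_cellBridge` of the registered skeleton
`Cruxes/MagicFormulaT/Lines/Sketch.lean`.  The open Voronoi cell of the site `a` of the unit lattice
`𝕋` is the open hexagon `H_a = {z | |hform i (z − triMeshPoint 1 a)| < 1, i = 0, 1, 2}` (written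
inline, as in the stub; `hform i = X − Y, X + 2Y, 2X + Y` are the hex forms of
`HexLatticeSegments.lean`).  This file proves, by the hex-form arithmetic of
`Cruxes/MagicFormulaT/Disproof.lean` (`half_le_norm_sub_triEmbed_of_mem_hexEdge`), that

* every point `q` of a closed honeycomb edge `[c(F), c(oppFace F j)]` has, for every site `a`, a hex
  form with `|hform i (q − a)| ≥ 1` (`exists_one_le_abs_hform_sub_of_mem_hexEdge`): the type form of
  the edge is integral along it; if it differs from its integral value at `a` we are done, otherwise
  one of the two other forms runs between two nonzero integers of the same sign;
* hence the trace `polyTrace 1 w` of a site interface loop `w` (a union of such edges,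
  `IsSiteInterfaceLoop.getVert_succ_eq`) misses every open cell (`cellBridge_tracesMissHexCells`,
  the sub-goal registered on the crux for this helper file).

Consequently the winding number of an interface loop is constant on each cell (used in the stub
file).
Folklore planar geometry; no named facts.
-/

noncomputable section

namespace Summit.CriticalPhenomena.CardyFormulaZ2.Cruxes.MagicFormulaT.LineSketch

open Set
open Literature.Probability.Percolation Literature.Probability.LatticeModels

/-- **Face centres are not sites** (the `X`-coordinate of a face centre is a third-integer).
-- adapted from Cruxes/MagicFormulaT/Disproof.lean (`hexCenter_ne_triEmbed`) -/
theorem hexCenter_ne_triEmbed' (G : HexVertex) (a : Site 2) : hexCenter G ≠ triEmbed a := by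
  rcases G with ⟨y, s⟩
  intro h
  have hX := congrArg triX h
  rw [triX_hexCenter, triX_triEmbed] at hX
  have key : (3 : ℝ) * ((a 0 : ℤ) - y 0 : ℝ) = (s : ℕ) + 1 := by linarith
  have key' : (3 : ℤ) * (a 0 - y 0) = (s : ℕ) + 1 := by exact_mod_cast key
  have hs := s.isLt
  omega

/-- **Every point of a closed honeycomb edge has a hex form at distance `≥ 1` from its value at any
site.**  The type form of the edge is integral along it; if it differs from its (integral) value at
the site we are done, and if not, one of the other two forms runs between two nonzero integers of
the same sign along the edge.
-- adapted from Cruxes/MagicFormulaT/Disproof.lean (`half_le_norm_sub_triEmbed_of_mem_hexEdge`) -/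
theorem exists_one_le_abs_hform_sub_of_mem_hexEdge {F : HexVertex} {j : Fin 3} {q : ℂ}
    (hq : q ∈ segment ℝ (hexCenter F) (hexCenter (oppFace F j))) (a : Site 2) :
    ∃ i, 1 ≤ |hform i (q - triEmbed a)| := by
  -- hex-form bookkeeping: subtraction, integrality at sites
  have hsub : ∀ (i : Fin 3) (p r : ℂ), hform i (p - r) = hform i p - hform i r := by
    intro i p r
    fin_cases i <;> simp [hform, triX_sub, triY_sub] <;> ring
  have hint : ∀ i : Fin 3, ∃ m : ℤ, hform i (triEmbed a) = m := by
    intro i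
    fin_cases i
    · exact ⟨a 0 - a 1, by simp [triX_triEmbed, triY_triEmbed]⟩
    · exact ⟨a 0 + 2 * a 1, by simp [triX_triEmbed, triY_triEmbed]⟩
    · exact ⟨2 * a 0 + a 1, by simp [triX_triEmbed, triY_triEmbed]⟩
  choose m hm using hint
  rcases F with ⟨x, t⟩
  obtain ⟨θ, h0, h1, hθ0⟩ := exists_param_of_mem_hexEdge hq
  have hθ : ∀ i, hform i q = hform i (hexCenter (x, t)) + θ * hdelta t j i := hθ0
  -- the forms of `q - a`
  have hD : ∀ i, hform i (q - triEmbed a) = (hformZ i x t : ℝ) - (m i : ℝ) + θ * hdelta t j i := by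
    intro i
    rw [hsub, hθ i, hform_hexCenter, hm]
    ring
  -- it suffices to find a form of square ≥ 1
  suffices key : ∃ i, 1 ≤ hform i (q - triEmbed a) ^ 2 by
    obtain ⟨i, hi⟩ := key
    exact ⟨i, (one_le_sq_iff_one_le_abs _).1 hi⟩
  set i₀ := htype t j with hi₀
  by_cases hk : hformZ i₀ x t - m i₀ = 0
  · -- the site lies on the line of the edge: use the next form
    set i₁ : Fin 3 := i₀ + 1 with hi₁
    have hne : i₁ ≠ i₀ := by
      rw [hi₁]; clear_value i₀; fin_cases i₀ <;> decide
    have hε := hdelta_eq_one_or_of_ne (t := t) (j := j) (i := i₁) (by rwa [← hi₀])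
    set d₀ : ℤ := hformZ i₁ x t - m i₁ with hd₀
    -- `d₀ ≠ 0`: else the centre of `F` would be the site `a`
    have hk0 : hform i₀ (hexCenter (x, t)) = hform i₀ (triEmbed a) := by
      rw [hform_hexCenter, hm]
      have : (hformZ i₀ x t : ℝ) - (m i₀ : ℝ) = 0 := by exact_mod_cast hk
      linarith
    have hd₀ne : d₀ ≠ 0 := by
      intro h
      apply hexCenter_ne_triEmbed' (x, t) a
      refine eq_of_hform_eq hne ?_ hk0
      rw [hform_hexCenter, hm]
      have : (hformZ i₁ x t : ℝ) - (m i₁ : ℝ) = 0 := by rw [hd₀] at h; exact_mod_cast h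
      linarith
    -- `d₀ + ε ≠ 0`: else the centre of the opposite face would be the site `a`
    have hd₁ne : (d₀ : ℝ) + hdelta t j i₁ ≠ 0 := by
      intro h
      apply hexCenter_ne_triEmbed' (oppFace (x, t) j) a
      refine eq_of_hform_eq hne ?_ ?_
      · have e1 : hform i₁ (hexCenter (oppFace (x, t) j)) =
            hform i₁ (hexCenter (x, t)) + hdelta t j i₁ := hform_hexCenter_oppFace i₁ (x, t) j
        rw [e1, hform_hexCenter, hm]
        have : ((hformZ i₁ x t : ℝ) - (m i₁ : ℝ)) + hdelta t j i₁ = 0 := by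
          rw [hd₀] at h; push_cast at h; exact h
        linarith
      · have e0 : hform i₀ (hexCenter (oppFace (x, t) j)) =
            hform i₀ (hexCenter (x, t)) + hdelta t j i₀ := hform_hexCenter_oppFace i₀ (x, t) j
        rw [e0, hk0, hi₀, hdelta_htype, add_zero]
    refine ⟨i₁, ?_⟩
    have hDi : hform i₁ (q - triEmbed a) = (d₀ : ℝ) + θ * hdelta t j i₁ := by
      rw [hD, hd₀]; push_cast; ring
    rw [hDi]
    rcases hε with hε | hε <;> rw [hε] at hd₁ne ⊢
    · have hcase : (1 : ℤ) ≤ d₀ ∨ d₀ ≤ -2 := by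
        have : d₀ + 1 ≠ 0 := fun h ↦ hd₁ne (by exact_mod_cast h)
        omega
      rcases hcase with h | h
      · have : (1 : ℝ) ≤ d₀ := by exact_mod_cast h
        nlinarith
      · have : (d₀ : ℝ) ≤ -2 := by exact_mod_cast h
        nlinarith
    · have hcase : (2 : ℤ) ≤ d₀ ∨ d₀ ≤ -1 := by
        have : d₀ - 1 ≠ 0 := fun h ↦ hd₁ne (by exact_mod_cast h)
        omega
      rcases hcase with h | h
      · have : (2 : ℝ) ≤ d₀ := by exact_mod_cast h
        nlinarith
      · have : (d₀ : ℝ) ≤ -1 := by exact_mod_cast h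
        nlinarith
  · -- the type form differs by a nonzero integer
    refine ⟨i₀, ?_⟩
    have hDi : hform i₀ (q - triEmbed a) = ((hformZ i₀ x t - m i₀ : ℤ) : ℝ) := by
      rw [hD, hi₀, hdelta_htype]; push_cast; ring
    rw [hDi]
    have hcase : (1 : ℤ) ≤ hformZ i₀ x t - m i₀ ∨ hformZ i₀ x t - m i₀ ≤ -1 := by omega
    rcases hcase with h | h
    · have : (1 : ℝ) ≤ ((hformZ i₀ x t - m i₀ : ℤ) : ℝ) := by exact_mod_cast h
      nlinarith
    · have : ((hformZ i₀ x t - m i₀ : ℤ) : ℝ) ≤ -1 := by exact_mod_cast h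
      nlinarith

/-- **Every point of the trace of a site interface loop at mesh `1` has, for every site `a`, a hex
form with `|hform i (q − a)| ≥ 1`**: the trace is a union of closed honeycomb edges
(`mem_polyTrace_iff`, `IsSiteInterfaceLoop.getVert_succ_eq`). -/
theorem exists_one_le_abs_hform_sub_of_mem_polyTrace {ω : SiteConfig (Site 2)} {f₀ : HexVertex}
    {w : hexGraph.Walk f₀ f₀} (hw : IsSiteInterfaceLoop ω w) {q : ℂ} (hq : q ∈ polyTrace 1 w)
    (a : Site 2) : ∃ i, 1 ≤ |hform i (q - triEmbed a)| := by
  obtain ⟨k, hk, hqk⟩ := mem_polyTrace_iff.1 hq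
  rw [polyPiece, polyPt, polyPt, hw.getVert_succ_eq hk, Complex.ofReal_one, one_mul, one_mul] at hqk
  exact exists_one_le_abs_hform_sub_of_mem_hexEdge hqk a

/-! ## Registered sub-goal -/

/-- **Sub-goal `cellBridge_tracesMissHexCells` of stub `stub_cellBridge`: the trace of a site
interface loop at mesh `1` misses every open Voronoi cell.** -/
theorem cellBridge_tracesMissHexCells : ∀ (ω : SiteConfig (Site 2)) (f₀ : HexVertex)
    (w : hexGraph.Walk f₀ f₀), IsSiteInterfaceLoop ω w → ∀ a : Site 2,
      Disjoint {z : ℂ | ∀ i : Fin 3, |hform i (z - triMeshPoint 1 a)| < 1} (polyTrace 1 w) := by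
  intro ω f₀ w hw a
  refine Set.disjoint_left.2 fun q hq hq' ↦ ?_
  obtain ⟨i, hi⟩ := exists_one_le_abs_hform_sub_of_mem_polyTrace hw hq' a
  have h := hq i
  rw [triMeshPoint, Complex.ofReal_one, one_mul] at h
  exact absurd h (not_lt.2 hi)

end Summit.CriticalPhenomena.CardyFormulaZ2.Cruxes.MagicFormulaT.LineSketch

end
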